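/-
Origin: expansion seat `planner-pub-hodgecm-carver-g2-0`, handover v2 2026-08-18T04:09:31Z (`HOME/pub-hodgecm-carver-g2/lean/CarverG2/PerL34/AssemblyLeaves.lean`, md5 be52db9b, 137 lines);
landed by the gen-5 packager in gate run 21 as `HodgeCM/PerL34/AssemblyLeaves.lean` (verbatim).
-/
/-
pub-hodgecm cell — THE CARVER gen 2 (session planner-pub-hodgecm-carver-g2-0, unit pub-hodgecm-carver-g2).
`AssemblyLeaves`: BY-NAME WIRING ONLY — no mathematical content, nothing posited, nothing cited.  It plugs the
run-18/19 LANDED by-name feeders of LEMMAS.md v3 §4/§8 into the Landherr-free assembly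
`HodgeCM.PerL34.perL_of_nodes''` (landherr-g2, `AssemblyNoLandherr.lean`):
  h29 := `Universe.ThetaModel.Open_occ_of_archC` (pv06, `ArchC.lean` :431)            — F8 of LEMMAS §8,
  h31 := `HodgeCM.PerL34.N31_of_cluster` (pv13, `CharsAssembly.lean` :199)            — F9,
  h33 := `HodgeCM.PerL34.WedgeToClasses.open_thetaWedge_of_printSteps` (pv03, `WedgeFromLineField.lean` :146)
         with its two kernel arguments DISCHARGED here: `HodgeCM.levelDirected` (prl1, `Proofs/LevelDirected.lean`
         :137) and pv01's `HodgeCM.PerL34.N33e_holds` (`LineField.lean` :393) via the one-line glue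
         `n33eClosed_holds` announced in the `WedgeFromLineField` docstring (l. 40)            — F10.
So the remaining hypotheses of `perL_of_leaves` are exactly: PRINT {h07, h09a, h09b} · DESIGN {h12b} · OPEN-INPUT
{h12a = `Open_thetaSub`, h19w = `Open_thetaGen12`, h19g = `Open_thetaReal34` (pv08's adapter `OpenInputsN19` is
not landed yet)} · DATA {`Pc`/`A12`/`A34` = per-context Lemma-4.1(c) data (`ArchCDatum`), `h31 : ClusterOutputs T`
(per-context/side/character `LocalFactorDatum`s + the N31h (ii) field), `h33 : StepsPrintInput T` (per-context
topological forms dictionary with N33c, the PRINT shell facts, L4.2(b) and the D2/D6 dictionary fields)}.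
v2 (after the run-20 intake of 04:00Z put pv08's `OpenInputsN19` in the tree): h19w/h19g are ALSO fed BY NAME —
`open_thetaGen12_of_genIdentity` (:60; its `Open_chars` argument := pv13 `open_chars_of_cluster`) and
`open_thetaReal34_of_core` (:70) — so `perL_of_leaves'` keeps only the model-level leaves `N19w_genIdentity` (12 side)
and `N19g_core` (34 side) per good context (LEMMAS §9 seam S5).
Intended place (packager's call): `HodgeCM/PerL34/AssemblyLeaves.lean`; module rename `CarverG2.PerL34.` ↦
`HodgeCM.PerL34.`.  Imports: landed modules only.
-/
import Summits.HodgeConjecture.HodgeCM.PerL34.AssemblyNoLandherr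
import Summits.HodgeConjecture.HodgeCM.PerL34.CharsAssembly
import Summits.HodgeConjecture.HodgeCM.PerL34.ArchC_2
import Summits.HodgeConjecture.HodgeCM.PerL34.WedgeFromLineField
import Summits.HodgeConjecture.HodgeCM.PerL34.LineField
import Summits.HodgeConjecture.HodgeCM.PerL34.OpenInputsN19
import Summits.HodgeConjecture.HodgeCM.Proofs.LevelDirected

/-! PORT of `HodgeCM/PerL34/AssemblyLeaves.lean` (HodgeCMPerL run 82) — verbatim mechanical port; provenance in the PORT header line. -/

set_option autoImplicit false

noncomputable section

namespace HodgeCM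
namespace PerL34

open HodgeCM.Prior.Perl34File HodgeCM.Prior.Perl34File.Perl34 HodgeCM.PerL34.ArchC

/-- **Glue (pv03 ⟵ pv01):** pv01's kernel-checked closed N33e statement `N33e_holds` proves pv03's verbatim copy
`WedgeToClasses.N33eClosed` by definitional unfolding (`LineField.StableUnder` and `WedgeNonvanishing.StableUnder`
have the same body).  This is the one-line glue stated in the `WedgeFromLineField` docstring. -/
theorem n33eClosed_holds : WedgeToClasses.N33eClosed :=
  fun G X W _ _ _ _ _ _ _ Δ hΔ ht A hi x₀ hc e hK 𝒰₁ 𝒰₂ h₁ h₂ s₁ s₂ n₁ n₂ =>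
    N33e_holds G X W Δ hΔ ht A hi x₀ hc e hK 𝒰₁ 𝒰₂ h₁ h₂ s₁ s₂ n₁ n₂

variable {U : Universe}

/-- **N33 (= `Open_thetaWedge`, "the heart") BY NAME from pv03's print-steps input alone**: the `LevelDirected`
and `N33eClosed` arguments of `open_thetaWedge_of_printSteps` are theorems of the package. -/
theorem N33_wedge_of_printSteps (T : U.ThetaModel) (h : WedgeToClasses.StepsPrintInput T) : N33_wedge T :=
  (N33_iff T).mpr (WedgeToClasses.open_thetaWedge_of_printSteps T HodgeCM.levelDirected n33eClosed_holds h)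

/-- **N29 (= `Open_occ`) BY NAME from per-context Lemma-4.1(c) data** (pv06 `Open_occ_of_archC`). -/
theorem N29_occ_of_archC (T : U.ThetaModel)
    (Pc : ∀ {L : CMField} {ι₁ : L →+* ℂ} (V : HermSpace3 L ι₁) (c : SeesawCtx L),
      C4a.PointedCore (T.core V c))
    (A12 : ∀ {L : CMField} {ι₁ : L →+* ℂ} (V : HermSpace3 L ι₁) (c : SeesawCtx L),
      T.GoodCtx ι₁ c → Nonempty (ArchCDatum (T.core V c) (T.t12 V c) (Pc V c)))
    (A34 : ∀ {L : CMField} {ι₁ : L →+* ℂ} (V : HermSpace3 L ι₁) (c : SeesawCtx L),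
      T.GoodCtx ι₁ c → Nonempty (ArchCDatum (T.core V c) (T.t34 V c) (Pc V c))) :
    N29_occ T :=
  (N29_iff T).mpr (T.Open_occ_of_archC Pc A12 A34)

/-- **N31 (= `Open_chars`, Lemma 4.2(b)) BY NAME from the cluster outputs** (pv13 `N31_of_cluster`; restated
here only so that the three feeders sit side by side). -/
theorem N31_chars_of_cluster (T : U.ThetaModel) (h : ClusterOutputs T) : N31_chars T :=
  N31_of_cluster T h

/-- **PerL from the leaves (LEMMAS.md v3 §8, run-19 state).**  `perL_of_nodes''` with h29, h31, h33 fed BY NAME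
from the landed feeders; every remaining binder is a PRINT fact (h07, h09a, h09b), a DESIGN constraint (h12b), a
PerL open input not yet adapted by name (h12a, h19w, h19g), or a labelled DATA record (Pc/A12/A34, h31, h33).
PROVED; closure = the standard trio (all ingredients are audited run-18/19 theorems). -/
theorem perL_of_leaves (M : U.ModelAxioms) (T : U.ThetaModel)
    (h07 : N07_hodgeRiemann20 U) (h09a : N09a_embCover T) (h09b : N09b_innerEmb T)
    (h12a : N12a_thetaSub T) (h12b : N12b_signRecipe T)
    (h19w : N19w_wedgeMem T) (h19g : N19g_genInWedgeSpan T)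
    (Pc : ∀ {L : CMField} {ι₁ : L →+* ℂ} (V : HermSpace3 L ι₁) (c : SeesawCtx L),
      C4a.PointedCore (T.core V c))
    (A12 : ∀ {L : CMField} {ι₁ : L →+* ℂ} (V : HermSpace3 L ι₁) (c : SeesawCtx L),
      T.GoodCtx ι₁ c → Nonempty (ArchCDatum (T.core V c) (T.t12 V c) (Pc V c)))
    (A34 : ∀ {L : CMField} {ι₁ : L →+* ℂ} (V : HermSpace3 L ι₁) (c : SeesawCtx L),
      T.GoodCtx ι₁ c → Nonempty (ArchCDatum (T.core V c) (T.t34 V c) (Pc V c)))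
    (h31 : ClusterOutputs T) (h33 : WedgeToClasses.StepsPrintInput T) : U.PerL :=
  perL_of_nodes'' M T h07 h09a h09b h12a h12b h19w h19g (N29_occ_of_archC T Pc A12 A34)
    (N31_chars_of_cluster T h31) (N33_wedge_of_printSteps T h33)

/-- The same, feeding the SPLIT variant (`perL_of_nodes_split''`) with pv13's `N31_split_of_cluster`. -/
theorem perL_of_leaves_split (M : U.ModelAxioms) (T : U.ThetaModel)
    (h07 : N07_hodgeRiemann20 U) (h09a : N09a_embCover T) (h09b : N09b_innerEmb T)
    (h12a : N12a_thetaSub T) (h12b : N12b_signRecipe T)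
    (h19w : N19w_wedgeMem T) (h19g : N19g_genInWedgeSpan T) (h29 : N29_split T)
    (h31 : ClusterOutputs T) (h33 : WedgeToClasses.StepsPrintInput T) : U.PerL :=
  perL_of_nodes_split'' M T h07 h09a h09b h12a h12b h19w h19g h29 (N31_split_of_cluster T h31)
    (N33_wedge_of_printSteps T h33)

/-- **N19w (= `Open_thetaGen12`) BY NAME** from the model-level seesaw-generator identity on the (12) side and the
cluster outputs (pv08 `open_thetaGen12_of_genIdentity` ∘ pv13 `open_chars_of_cluster`). -/
theorem N19w_wedgeMem_of_genIdentity (T : U.ThetaModel)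
    (hgen : ∀ {L : CMField} {ι₁ : L →+* ℂ} (V : HermSpace3 L ι₁) (c : SeesawCtx L), T.GoodCtx ι₁ c →
      N19w_genIdentity T V c (T.t12 V c) 0 1)
    (h31 : ClusterOutputs T) : N19w_wedgeMem T :=
  open_thetaGen12_of_genIdentity T hgen (open_chars_of_cluster T h31)

/-- **N19g (= `Open_thetaReal34`) BY NAME** from the model-level core on the (34) side (pv08
`open_thetaReal34_of_core`). -/
theorem N19g_genInWedgeSpan_of_core (T : U.ThetaModel)
    (hcore : ∀ {L : CMField} {ι₁ : L →+* ℂ} (V : HermSpace3 L ι₁) (c : SeesawCtx L), T.GoodCtx ι₁ c →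
      N19g_core T V c (T.t34 V c) 2 3) : N19g_genInWedgeSpan T :=
  open_thetaReal34_of_core T hcore

/-- **PerL from the leaves, v2 (LEMMAS.md v4 §9): every PerL open input except `Open_thetaSub` fed BY NAME.**
Remaining binders: PRINT {h07, h09a, h09b} · DESIGN {h12b} · h12a (= `Open_thetaSub`; PRINT Liu 2021 modulo the
D1 dictionary, seam S6) · model-level leaves {hgen = `N19w_genIdentity` (seam S5), hcore = `N19g_core` (S5)} ·
labelled DATA {Pc/A12/A34 (S4), h31 (S3), h33 (S1/S2)}.  PROVED. -/
theorem perL_of_leaves' (M : U.ModelAxioms) (T : U.ThetaModel)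
    (h07 : N07_hodgeRiemann20 U) (h09a : N09a_embCover T) (h09b : N09b_innerEmb T)
    (h12a : N12a_thetaSub T) (h12b : N12b_signRecipe T)
    (hgen : ∀ {L : CMField} {ι₁ : L →+* ℂ} (V : HermSpace3 L ι₁) (c : SeesawCtx L), T.GoodCtx ι₁ c →
      N19w_genIdentity T V c (T.t12 V c) 0 1)
    (hcore : ∀ {L : CMField} {ι₁ : L →+* ℂ} (V : HermSpace3 L ι₁) (c : SeesawCtx L), T.GoodCtx ι₁ c →
      N19g_core T V c (T.t34 V c) 2 3)
    (Pc : ∀ {L : CMField} {ι₁ : L →+* ℂ} (V : HermSpace3 L ι₁) (c : SeesawCtx L),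
      C4a.PointedCore (T.core V c))
    (A12 : ∀ {L : CMField} {ι₁ : L →+* ℂ} (V : HermSpace3 L ι₁) (c : SeesawCtx L),
      T.GoodCtx ι₁ c → Nonempty (ArchCDatum (T.core V c) (T.t12 V c) (Pc V c)))
    (A34 : ∀ {L : CMField} {ι₁ : L →+* ℂ} (V : HermSpace3 L ι₁) (c : SeesawCtx L),
      T.GoodCtx ι₁ c → Nonempty (ArchCDatum (T.core V c) (T.t34 V c) (Pc V c)))
    (h31 : ClusterOutputs T) (h33 : WedgeToClasses.StepsPrintInput T) : U.PerL :=
  perL_of_leaves M T h07 h09a h09b h12a h12b (N19w_wedgeMem_of_genIdentity T hgen h31)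
    (N19g_genInWedgeSpan_of_core T hcore) Pc A12 A34 h31 h33

end PerL34
end HodgeCM

end
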